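import Summits.BirchSwinnertonDyer.BirchSwinnertonDyer.Theses.ErratumRoadFive
import Summits.BirchSwinnertonDyer.BirchSwinnertonDyer.Theorems.ErratumRoadFiveErratumThm23SelfDualDecOfTwoVarCore
import Summits.BirchSwinnertonDyer.BirchSwinnertonDyer.Theorems.ErratumRoadFiveTwoVariableControlFiniteDefect
import Summits.BirchSwinnertonDyer.BirchSwinnertonDyer.Theorems.BiquadraticEisensteinDescentEisensteinHeartFlatCMInertBadKPrimeCharIdealBaseChange
import Literature.NumberTheory.EllipticCurves.PadicCoeffIntegersFrobeniusData
import Summits.BirchSwinnertonDyer.BirchSwinnertonDyer.Theorems.ErratumRoadFiveFixedPartOfThm326SelfDual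
import HarnessLib

/-!
# Crux `ErratumThm23SigmaLeSelfDual` (stmt-BirchSwinnertonDyer-23253, F4♯†) FROM THE ♭-PINNED TWO-VARIABLE CORE S1♭† AND
# [Wiles 1988 Thm 2.2] — the registered line `erratum_chain` v3‡ re-run on a WEAKER stub: the unit cofactor of the pin is IDLE
# (helper, `--supports stmt-BirchSwinnertonDyer-23253`; K7 «DIVPIN» of seat imc-p1, GO-independent)

Cell `bsd-stepL`, seat `bsd-stepL-imc-p1` (prover g34, 2026-08-29). Theorems only (no definition, no named fact, no `sorry`, no
instance, no notation). Imports the route file (to conclude the crux decl BY NAME) and otherwise route-independent modules.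

## The finding (idle-binder audit of the registered stub)

The line of record for crux 23253 is `Cruxes/ErratumThm23SigmaLeSelfDual/Lines/erratum_chain.lean` v3‡ (52ed63b5208a16a9, ONE stub
S1† `stub_FW21_twoVarSigmaLePinned_selfDual`, `_of := ErratumChainSelfDual.erratumThm23SigmaLeSelfDual_of_twoVarCore_of_thm326`,
p670957 = p663658 (dec)† + p665011 (¬(dec)†) + p670492 ((FIX)† ⟸ [W])). S1†'s conclusion is

    ∃ Q₂, (∃ u : (𝓞_ℂp⟦T_a⟧)ˣ, constantCoeff Q₂ = u * Q) ∧ Ch(X^Σ_K(A_g^†))·𝓞_ℂp ⊆ (Q₂)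

— a two-variable divisor `Q₂` PINNED to the BDP frame `Q` on `T_c = 0` UP TO A UNIT. In all three landed compositions the pin is consumed
ONLY through `TwoVariableDescent.map_constantCoeff_le_span_of_le_span_of_eq_unit_mul` (file `ErratumRoadFiveTwoVariableCharIdealDescent`),
whose proof is `Ideal.mul_mem_left`: the UNIT-ness of `u` is never used. So the crux follows, by the SAME kernel argument, from

    S1♭† := S1† with the pin replaced by  `∃ c : 𝓞_ℂp⟦T_a⟧, constantCoeff Q₂ = c * Q`   (every other character identical),

i.e. «the Σ-imprimitive weight-`k` BDP frame `Q` DIVIDES the anticyclotomic restriction `Q₂(T_c = 0)`». S1† ⟹ S1♭† binder for binder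
(`DivPin.exists_divPin_of_exists_unitPin` below, pointwise), so S1♭† is the WEAKER stub; the converse fails in general (e.g. `Q₂ = T_c + p·Q`
with `Q` a non-unit is a degree-one distinguished polynomial in `T_c`, so no divisor of it restricts to `unit·Q`).

What S1♭† asks of the unrefereed sources is strictly less: [FW21, Thm. 4.41] (`Ch(X^Σ_K ⊗ 𝒪^ur) ⊆ (𝓛^{Gr,Σ}_𝒦(g))`), [FW21 App. B
L. 7.22] (integrality of `𝓛^{Gr}_𝒦(g)`), and on the anticyclotomic line only that `L^Σ_p(g)` DIVIDES
`𝓛^{Gr,Σ}_𝒦(g)|_{T_c=0} = (𝓛^{Hida}_{f⊗𝐠}·𝓛^{Katz}_𝒦·h_𝒦)|_{T_c=0}` [FW21 App. B Cor. 7.21] in `𝓞_ℂp⟦T_a⟧` — NOT the erratum's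
«`L^{Gr,Σ}_p(g)_ac = L^Σ_p(g)` up to a p-adic unit» (p. 4, «by the same calculation as in [CGS23, Prop. 1.4.5]»): neither the unit-ness
of the weight-`k` CGS-type comparison constant nor that of the factor `h_𝒦·𝓛^{Katz}_𝒦|_{T_c=0}` is needed by K2. (For `A_g^†` the
anticyclotomic specialisation IS `T_c = 0`, TWIST AUDIT imc-p1 g24.)

## What this file proves

* `DivPin.map_constantCoeff_le_span_of_le_span_of_eq_mul` — the transport step for ANY cofactor (three lines);
  `DivPin.exists_divPin_of_exists_unitPin` — S1-conclusion ⟹ S1♭-conclusion pointwise; `DivPin.map_constantCoeff_le_span_of_exists_divPin`.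
* `erratumThm23SigmaLeSelfDual_of_twoVarCoreDivPin_of_thm326 (hFW : ‹S1♭†›) (hW : Hida2000_thm326_ordinary_unitRoot) :
    Theses.ErratumRoadFive.ErratumThm23SigmaLeSelfDual` — ONE theorem, both cases inline (the bodies of p663658 ∕ p665011 with
  `⟨u, hu⟩ ↦ ⟨c, hc⟩`, the local defect finite by the binder-free inner theorems `LocalDefectAtSelfDual.finite_localDefect_of_open_of_finN`
  ∘ `LocalDefectAtData.openDecompositionAtPbar` ∘ `LocalDefectAtSelfDual.finN_selfDual_of_finiteFixed` ∘
  `FixFinalSelfDual.finiteFixedPartAnomalous_selfDual_of_thm326 hW`, as in the ‡ chain p690124).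

For the pen: the line's ONE stub can be re-keyed S1† ↦ S1♭† with `_of := erratumThm23SigmaLeSelfDual_of_twoVarCoreDivPin_of_thm326 hFW hW`
(turnkey `HOME/imc-p1/g34/erratum_chain_selfdual-v4flat-proposed.lean`, W-79: not keyed by the seat); nothing downstream changes
(`closes` and every consumer take the crux F4♯†, not the stub). For the disprover: the ♭ pin is the sharper target — a field with
`p ∣ h_𝒦` or a non-unit comparison constant no longer refutes the stub; only a failure of DIVISIBILITY on the anticyclotomic line does.
The ‡ twin (print-faithful (i)∕(iii)) is the sequel `ErratumRoadFiveErratumThm23SelfDualIrrKOfTwoVarCoreDivPin`.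

HONEST FRAMING: CONDITIONAL on S1♭† (OPEN ∕ PRE: unrefereed [FW21, Thm. 4.41 + App. B] + the unprinted weight-`k` divisibility on the
anticyclotomic line) and on the named fact [W] (`Hida2000_thm326_ordinary_unitRoot`, route item 23081); the crux decl is concluded only
under these two displayed hypotheses; no crux, no route item and no summit statement is closed; BSD is proved for no pair; closes: none (T7).

[claim: FouquetWan2021, Thm. 4.41, App. B Cor. 7.21, Lemma 7.22, status: under-review] [claim: Castella2018Erratum, Thm. 2.3, status: under-review]
[cite: JetchevSkinnerWan2017, §3.4, Lemma 3.4.1, Cor. 3.4.2 (arXiv:1512.06894 p. 14)] [cite: Castella2018Erratum, §2 (p. 2), Lemma 2.1, proof of Thm. 2.3 (p. 4)]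
[cite: Wiles1988, Thm. 2.2] [cite: Rubin1991, §5 pp. 38–39] [cite: NeukirchSchmidtWingberg2008, Ch. V §1, (5.1.4) Remark 4]
-/

noncomputable section

-- D-0017: single-problem summit, the namespace repeats the problem name by design.
set_option linter.dupNamespace false
set_option autoImplicit false

open scoped Classical

open PowerSeries NumberField IsDedekindDomain Field
  Literature.NumberTheory.EllipticCurves Literature.NumberTheory.EllipticCurves.ModularForms
  Literature.NumberTheory.EllipticCurves.BigGaloisRep Literature.NumberTheory.EllipticCurves.GreenbergSelmer
  Literature.NumberTheory.GaloisRepresentations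

namespace Summit.BirchSwinnertonDyer.BirchSwinnertonDyer.Theorems.ErratumThm23TwoVariable

/-! ## §0 The only place the pin is consumed: `J ⊆ (𝓛₂)` and `𝓛₂(T_c = 0) = c · Q` give `J(T_c = 0) ⊆ (Q)` — for ANY `c` -/

namespace DivPin

/-- If `J ⊆ (𝓛₂)` in `B⟦T_a⟧⟦T_c⟧` and `𝓛₂(T_c = 0) = c · Q` for SOME `c ∈ B⟦T_a⟧` (not asked to be a unit), then `J(T_c = 0) ⊆ (Q)`.
This is `TwoVariableDescent.map_constantCoeff_le_span_of_le_span_of_eq_unit_mul` (p617763 lineage) with the unit hypothesis on the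
cofactor DROPPED — its proof never used it (`Ideal.mul_mem_left`). [folklore] -/
theorem map_constantCoeff_le_span_of_le_span_of_eq_mul {B : Type*} [CommRing B]
    {J : Ideal (PowerSeries (PowerSeries B))} {L₂ : PowerSeries (PowerSeries B)} (hJ : J ≤ Ideal.span {L₂})
    {c Q : PowerSeries B} (hc : PowerSeries.constantCoeff L₂ = c * Q) :
    J.map (PowerSeries.constantCoeff (R := PowerSeries B)) ≤ Ideal.span {Q} := by
  refine (Ideal.map_mono hJ).trans ?_
  rw [Ideal.map_span, Set.image_singleton, Ideal.span_singleton_le_iff_mem, hc]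
  exact Ideal.mul_mem_left _ _ (Ideal.mem_span_singleton_self Q)

/-- The ♭ pin is equivalent to bare ideal membership `𝓛₂(T_c = 0) ∈ (Q)`. [folklore] -/
theorem exists_eq_mul_iff_constantCoeff_mem_span {B : Type*} [CommRing B]
    (L₂ : PowerSeries (PowerSeries B)) (Q : PowerSeries B) :
    (∃ c : PowerSeries B, PowerSeries.constantCoeff L₂ = c * Q) ↔
      PowerSeries.constantCoeff (R := PowerSeries B) L₂ ∈ Ideal.span {Q} := by
  rw [Ideal.mem_span_singleton']
  exact ⟨fun ⟨c, hc⟩ => ⟨c, hc.symm⟩, fun ⟨c, hc⟩ => ⟨c, hc.symm⟩⟩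

/-- **S1 ⟹ S1♭ pointwise.** The registered pinned conclusion (unit cofactor) implies the ♭ conclusion (any cofactor): for every
ideal `J` of `B⟦T_a⟧⟦T_c⟧` and frame `Q`, «∃ 𝓛₂, (∃ unit u, 𝓛₂(T_c=0) = u·Q) ∧ J ⊆ (𝓛₂)» ⟹ «∃ 𝓛₂, (∃ c, 𝓛₂(T_c=0) = c·Q) ∧ J ⊆ (𝓛₂)».
So every stub of the `erratum_chain` family with the unit pin (S1†, S1‡; and bsd-wall's p = 3 twins) implies its ♭ form binder for binder:
the ♭ stubs are WEAKER statements (they ask less of [FW21 App. B Cor. 7.21] ∕ the weight-`k` CGS-type comparison). [folklore] -/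
theorem exists_divPin_of_exists_unitPin {B : Type*} [CommRing B]
    {J : Ideal (PowerSeries (PowerSeries B))} {Q : PowerSeries B}
    (h : ∃ L₂ : PowerSeries (PowerSeries B),
      (∃ u : (PowerSeries B)ˣ, PowerSeries.constantCoeff L₂ = (u : PowerSeries B) * Q) ∧ J ≤ Ideal.span {L₂}) :
    ∃ L₂ : PowerSeries (PowerSeries B),
      (∃ c : PowerSeries B, PowerSeries.constantCoeff L₂ = c * Q) ∧ J ≤ Ideal.span {L₂} := by
  obtain ⟨L₂, ⟨u, hu⟩, hJ⟩ := h
  exact ⟨L₂, ⟨(u : PowerSeries B), hu⟩, hJ⟩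

/-- Conversely the ♭ conclusion already yields what every composition of the line consumes: `J(T_c = 0) ⊆ (Q)`. [folklore] -/
theorem map_constantCoeff_le_span_of_exists_divPin {B : Type*} [CommRing B]
    {J : Ideal (PowerSeries (PowerSeries B))} {Q : PowerSeries B}
    (h : ∃ L₂ : PowerSeries (PowerSeries B),
      (∃ c : PowerSeries B, PowerSeries.constantCoeff L₂ = c * Q) ∧ J ≤ Ideal.span {L₂}) :
    J.map (PowerSeries.constantCoeff (R := PowerSeries B)) ≤ Ideal.span {Q} := by
  obtain ⟨L₂, ⟨c, hc⟩, hJ⟩ := h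
  exact map_constantCoeff_le_span_of_le_span_of_eq_mul hJ hc

end DivPin

/-! ## §1 The crux† from S1♭† + [W] -/

namespace ErratumChainSelfDualDivPin

set_option maxHeartbeats 800000 in
-- statement-sized packages over the iterated big representation (as p663658 ∕ p665011 ∕ p690124); the proof is glue
/-- **Crux† ⟸ S1♭† + [Wiles 1988 Thm 2.2].** `hFW` = S1♭†: the registered stub S1† of line `erratum_chain` v3‡ (the OPEN two-variable core
[FW21, Thm. 4.41] Σ-imprimitive at the self-dual twist `A_g^†` + App. B Cor. 7.21 ∕ L. 7.22, footnote-1 hypotheses (i′)) with the ♭ PIN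
«the weight-`k` BDP frame `Q` DIVIDES `Q₂(T_c = 0)`» (`∃ c, constantCoeff Q₂ = c * Q`, the cofactor NOT asked to be a unit) — every other
character of S1† identical; `hW` = the named fact `Hida2000_thm326_ordinary_unitRoot` ([Wiles88 Thm. 2.2 ∕ Hida00 Thm. 3.26 (2)], route item
23081); conclusion = the route decl `Theses.ErratumRoadFive.ErratumThm23SigmaLeSelfDual` BY NAME. Proof: (glob)† from (i′); on (dec)† exact
control (body of p663658), on ¬(dec)† finite-defect control with the local defect finite by `finite_localDefect_of_open_of_finN ∘
openDecompositionAtPbar ∘ finN_selfDual_of_finiteFixed ∘ finiteFixedPartAnomalous_selfDual_of_thm326 hW` (body of p665011); in both cases the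
descent [JSW17, Cor. 3.4.2] and, at the end, `DivPin.map_constantCoeff_le_span_of_le_span_of_eq_mul` (any cofactor).
[cite: Castella2018Erratum, proof of Thm. 2.3: (2.4) ⇒ (2.5) (p. 4)] [cite: JetchevSkinnerWan2017, §3.4, Lemma 3.4.1, Cor. 3.4.2 (arXiv:1512.06894 p. 14)]
[cite: Wiles1988, Thm. 2.2] -/
theorem erratumThm23SigmaLeSelfDual_of_twoVarCoreDivPin_of_thm326
    (hFW :
    ∀ {p : ℕ} [Fact p.Prime] (ι : PadicAlgCl p ≃+* ℂ) {M : ℕ} [NeZero M] {k : ℤ}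
      (g : CuspForm (CongruenceSubgroup.Gamma0 M) k) (ιg : coeffField g →+* PadicAlgCl p)
      (Δ : OrdinaryNewformDatum g p ιg)
      (K : Type) [Field K] [NumberField K] (𝔭 𝔭bar : HeightOneSpectrum (𝓞 K)) (κ : ZpExtension K p)
      (γ : absoluteGaloisGroup K) [Fact (κ.IsTopGenerator γ)] (S : Finset (HeightOneSpectrum (𝓞 K))),
      IsNewform0 g → 2 ≤ k → Even k → 3 ≤ M → ¬ p ∣ M → 3 < p →
      (∀ x : coeffField g, ι (ιg x) = (x : ℂ)) →
      ‖ιg ⟨(UpperHalfPlane.qExpansion 1 ⇑g).coeff p, coeff_mem_coeffField g p⟩‖ = 1 →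
      IsImaginaryQuadratic K → (∃ β : ℤ, (4 * M : ℤ) ∣ β ^ 2 - NumberField.discr K) →
      ((Ideal.span {(p : ℤ)}).primesOver (𝓞 K)).ncard = 2 →
      ((p : ℕ) : 𝓞 K) ∈ 𝔭.asIdeal →
      (∀ (w : InfinitePlace K) (x : 𝓞 K), x ∈ 𝔭.asIdeal ↔ ‖ι.symm (w.embedding (x : K))‖ < 1) →
      ((p : ℕ) : 𝓞 K) ∈ 𝔭bar.asIdeal → 𝔭bar ≠ 𝔭 →
      SkinnerUrban2014.IsResiduallyIrreducible Δ →
      (∃ v : HeightOneSpectrum (𝓞 ℚ), SkinnerUrban2014.IsResiduallyRamifiedAt Δ v ∧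
        ((Rat.HeightOneSpectrum.primesEquiv v : Nat.Primes) : ℕ) ∣ M ∧
        ¬ ((Rat.HeightOneSpectrum.primesEquiv v : Nat.Primes) : ℕ) ^ 2 ∣ M ∧
        ((Ideal.span {(((Rat.HeightOneSpectrum.primesEquiv v : Nat.Primes) : ℕ) : ℤ)}).primesOver (𝓞 K)).ncard ≠ 2) →
      (((Ideal.span {(2 : ℤ)}).primesOver (𝓞 K)).ncard ≠ 2 → (2 ∣ M ∧ ¬ 4 ∣ M)) →
      (∀ ℓ : ℕ, ℓ.Prime → ℓ ∣ M → ((Ideal.span {(ℓ : ℤ)}).primesOver (𝓞 K)).ncard ≠ 2 →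
        ¬ ℓ ^ 2 ∣ M ∧ (UpperHalfPlane.qExpansion 1 ⇑g).coeff ℓ = -((ℓ : ℂ) ^ (k / 2 - 1).toNat)) →
      κ.IsAnticyclotomic → (∀ w ∈ S, ((p : ℕ) : 𝓞 K) ∉ w.asIdeal) →
      (∀ w : HeightOneSpectrum (𝓞 K), ((M : ℕ) : 𝓞 K) ∈ w.asIdeal → w ∈ S) →
      ∀ (b : padicCoeffIntegers ιg →+* PadicComplexInt p),
        (∀ x, ((b x : PadicComplexInt p) : ℂ_[p]) =
          algebraMap (PadicAlgCl p) ℂ_[p] (padicCoeffIntegers.toPadicAlgCl ιg x)) →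
      ∀ (ΩK : ℂ) (Ωp : (PadicComplexInt p)ˣ) (Q : PowerSeries (PadicComplexInt p)), ΩK ≠ 0 →
        IsBDPLFunctionWtSigmaInt ι 𝔭 κ γ g S ΩK ((Ωp : PadicComplexInt p) : ℂ_[p]) Q →
      -- the complementary (cyclotomic) direction `κ'` with generator `γ'`: `Γ_K = Γ⁺ ⊕ Γ⁻ ≅ ℤ_p²` for `p` odd
      ∀ (κ' : ZpExtension K p) (γ' : absoluteGaloisGroup K) [Fact (κ'.IsTopGenerator γ')], κ'.IsCyclotomic →
      ∀ [TopologicalSpace (PowerSeries (padicCoeffIntegers ιg))]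
        [TopologicalSpace (PowerSeries (PowerSeries (padicCoeffIntegers ιg)))]
        [ContinuousSMul (PowerSeries (PowerSeries (padicCoeffIntegers ιg)))
          (BigRepModule (PowerSeries (padicCoeffIntegers ιg)) p
            (BigRepModule (padicCoeffIntegers ιg) p (Cofree Δ.selfDualRep (padicCoeffField ιg))))],
      -- premise: `X^Σ_K(A_g)` is `Λ_K`-torsion; conclusion: a two-variable frame pinned to `Q` on `X = 0` dividing `Ch_{Λ_K}(X^Σ_K(A_g))`
      Module.IsTorsion (PowerSeries (PowerSeries (padicCoeffIntegers ιg)))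
          (XBig κ' (AnticyclotomicBigGaloisRep κ (Δ.selfDualCofreeRepOver K)) 𝔭bar (↑S)) →
      ∃ Q₂ : PowerSeries (PowerSeries (PadicComplexInt p)),
        -- ♭ pin: the frame `Q` DIVIDES the anticyclotomic restriction `Q₂(T_c = 0)` (any cofactor `c`, NOT asked to be a unit)
        (∃ c : PowerSeries (PadicComplexInt p), PowerSeries.constantCoeff Q₂ = c * Q) ∧
        (XBig.charIdeal κ' (AnticyclotomicBigGaloisRep κ (Δ.selfDualCofreeRepOver K)) 𝔭bar (↑S)).map
            (PowerSeries.map (PowerSeries.map b)) ≤ Ideal.span {Q₂} )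
    (hW : Literature.NumberTheory.EllipticCurves.Hida2000_thm326_ordinary_unitRoot) :
    Summit.BirchSwinnertonDyer.BirchSwinnertonDyer.Theses.ErratumRoadFive.ErratumThm23SigmaLeSelfDual := by
  intro p _ ι M _ k g ιg Δ K _ _ 𝔭 𝔭bar κ γ _ S h1 h2 h3 h4 h5 h6 h7 h8 h9 h10 h11 h12 h13 h14 h15 h16 h17
    h18 h19 h20 h21 h22 b h23 ΩK Ωp Q h24 h25 _i1 _i2 h26
  -- (glob)† from irreducibility (i′) (tree theorem)
  have hglob := SelfDualTwist.noFixedTorsion_selfDual_of_isResiduallyIrreducible' Δ K h6 h9 h16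
  -- a cyclotomic `ℤ_p`-extension with a topological generator; any topology on `Λ_K` (the conclusion does not see it)
  obtain ⟨κ', hκ'⟩ := Literature.NumberTheory.EllipticCurves.exists_cyclotomicZpExtension_holds K p
  obtain ⟨γ', hγ'⟩ := κ'.surjective (Multiplicative.ofAdd 1)
  haveI : Fact (κ'.IsTopGenerator γ') := ⟨hγ'⟩
  letI : TopologicalSpace (PowerSeries (PowerSeries (padicCoeffIntegers ιg))) := ⊥
  haveI : DiscreteTopology (PowerSeries (PowerSeries (padicCoeffIntegers ιg))) := ⟨rfl⟩
  -- (unr)† and the one-variable finite generation, from the tree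
  have hSM' : ∀ w : HeightOneSpectrum (𝓞 K), w ∉ (↑S : Set (HeightOneSpectrum (𝓞 K))) →
      ((M : ℕ) : 𝓞 K) ∉ w.asIdeal := fun w hw hM ↦ hw (Finset.mem_coe.2 (h22 w hM))
  have hunr := SelfDualTwist.selfDualCofreeRepOver_localMap_inr_apply_eq_self Δ K (↑S) hSM'
  haveI := CoeffRing.finiteDimensional_padicCoeffField ιg h1
  haveI : Module.Finite (PowerSeries (padicCoeffIntegers ιg)) (XBig κ (Δ.selfDualCofreeRepOver K) 𝔭bar (↑S)) :=
    SkinnerUrban2014.moduleFinite_XBig κ 𝔭bar (↑S) S.finite_toSet (Δ.selfDualCofreeRepOver K)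
      (GreenbergSelmer.Cofree.exists_pow_psmul_eq_zero ιg Δ.selfDualRep)
      (GreenbergSelmer.Cofree.divisible (padicCoeffField ιg) Δ.selfDualRep (Fact.out : p.Prime).ne_zero)
      (GreenbergSelmer.Cofree.finite_setOf_psmul_eq_zero ιg Δ.selfDualRep) hunr
  -- ring-theoretic clauses for the newform's coefficient ring
  haveI : IsPrincipalIdealRing (padicCoeffIntegers ιg) := CoeffRing.isPrincipalIdealRing ιg
  haveI : UniqueFactorizationMonoid (PowerSeries (PowerSeries (padicCoeffIntegers ιg))) :=
    CoeffRing.uniqueFactorizationMonoid_powerSeries_powerSeries ιg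
  by_cases hdec : ∀ a : Cofree Δ.selfDualRep (padicCoeffField ιg),
      (∀ σ : LocalGroup K (Sum.inl 𝔭bar), (Δ.selfDualCofreeRepOver K) (localMap K (Sum.inl 𝔭bar) σ) a = a) →
      (∃ j : ℕ, p ^ j • a = 0) → a = 0
  · /- (dec)†: EXACT control (body of p663658) -/
    haveI := ControlAt.module_finite_XBig_iterate κ κ' (Δ.selfDualCofreeRepOver K) 𝔭bar (↑S) hglob hdec hunr
    -- the EXACT control map (kernel zero, hence pseudo-null), packaged with `Exists.choose`
    have key := ControlAt.exists_controlMap κ κ' (Δ.selfDualCofreeRepOver K) 𝔭bar (↑S) hglob hdec hunr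
    -- two-variable torsion from the one-variable torsion premise + control (determinant trick)
    have hs := TwoVariableDescent.exists_constantCoeff_ne_zero_of_control
      (A := PowerSeries (padicCoeffIntegers ιg))
      (XBig κ' (AnticyclotomicBigGaloisRep κ (Δ.selfDualCofreeRepOver K)) 𝔭bar (↑S))
      (XBig κ (Δ.selfDualCofreeRepOver K) 𝔭bar (↑S)) h26 key.choose key.choose_spec.2.2
    have htors₂ := TwoVariableDescent.isTorsion_of_exists_constantCoeff_ne_zero
      (A := PowerSeries (padicCoeffIntegers ιg))
      (XBig κ' (AnticyclotomicBigGaloisRep κ (Δ.selfDualCofreeRepOver K)) 𝔭bar (↑S)) hs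
    -- the two-variable core WITH THE ♭ PIN, for this cyclotomic `κ'`
    obtain ⟨Q₂, ⟨c, hc⟩, hle⟩ := hFW ι g ιg Δ K 𝔭 𝔭bar κ γ S h1 h2 h3 h4 h5 h6 h7 h8 h9 h10 h11 h12 h13
      h14 h15 h16 h17 h18 h19 h20 h21 h22 b h23 ΩK Ωp Q h24 h25 κ' γ' hκ' htors₂
    -- descent of the characteristic ideal along `T_c ↦ 0` (JSW Cor. 3.4.2, kernel form), read in `𝓞_{ℂ_p}`
    have hdesc := TwoVariableDescent.charIdeal_le_map_constantCoeff_of_control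
      (A := PowerSeries (padicCoeffIntegers ιg))
      (XBig κ' (AnticyclotomicBigGaloisRep κ (Δ.selfDualCofreeRepOver K)) 𝔭bar (↑S))
      (XBig κ (Δ.selfDualCofreeRepOver K) 𝔭bar (↑S)) h26 key.choose key.choose_spec.1 key.choose_spec.2.2
    refine (Ideal.map_mono hdesc).trans ?_
    rw [TwoVariableDescent.map_map_constantCoeff_eq b]
    exact DivPin.map_constantCoeff_le_span_of_le_span_of_eq_mul hle hc
  · /- ¬(dec)†: FINITE-DEFECT control (body of p665011), the local defect finite by the binder-free inner theorems of
       `LocalDefectAtSelfDual` ∕ `LocalDefectAtData` ∕ `FixFinalSelfDual` ((FIX)† ⟸ [W]) -/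
    have hfin : Finite (QuotSMulTop (PowerSeries.X : PowerSeries (PowerSeries (padicCoeffIntegers ιg)))
        ↥((((AnticyclotomicBigGaloisRep κ' (AnticyclotomicBigGaloisRep κ (Δ.selfDualCofreeRepOver K))).restrict
          (localMap K (Sum.inl 𝔭bar))).toTopRep).ρ.invariants)) :=
      LocalDefectAtSelfDual.finite_localDefect_of_open_of_finN Δ K 𝔭bar κ κ'
        (LocalDefectAtData.openDecompositionAtPbar K 𝔭bar κ κ' h6 h9 h11 h14 h20 hκ')
        (LocalDefectAtSelfDual.finN_selfDual_of_finiteFixed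
          (FixFinalSelfDual.finiteFixedPartAnomalous_selfDual_of_thm326 hW)
          g ιg Δ K 𝔭bar κ κ' h1 h2 h3 h5 h6 h8 h9 h11 h14 h20 hκ')
    haveI := ControlFiniteDefect.module_finite_XBig_iterate_of_finite_defect κ κ' (Δ.selfDualCofreeRepOver K) 𝔭bar (↑S)
      hglob hunr hfin
    have key := ControlFiniteDefect.exists_controlMap_of_finite_defect κ κ' (Δ.selfDualCofreeRepOver K) 𝔭bar (↑S)
      hglob hunr hfin
    -- its finite kernel is pseudo-null over `Λ_𝒪`
    letI : _root_.Module (PowerSeries (padicCoeffIntegers ιg))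
        (QuotSMulTop (PowerSeries.X : PowerSeries (PowerSeries (padicCoeffIntegers ιg)))
          (XBig κ' (AnticyclotomicBigGaloisRep κ (Δ.selfDualCofreeRepOver K)) 𝔭bar (↑S))) :=
      Module.compHom _ (PowerSeries.C (R := PowerSeries (padicCoeffIntegers ιg)))
    haveI : Finite (LinearMap.ker key.choose) := key.choose_spec.2
    -- (`𝒪 = padicCoeffIntegers ι_g` is a DVR, transported from the unit ball of the finite extension `ℚ_p(ι_g K_g)`;
    -- a finite `Λ_𝒪`-module is pseudo-null)
    haveI : IsDiscreteValuationRing (padicCoeffIntegers ιg) := by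
      haveI := CoeffRing.isDiscreteValuationRing_unitBall (p := p) (padicCoeffField ιg)
      obtain ⟨e, -, -⟩ := GreenbergSelmer.exists_ringEquiv_unitBall ιg
      exact IsDiscreteValuationRing.RingEquivClass.isDiscreteValuationRing e.symm
    have hpn : Literature.NumberTheory.EllipticCurves.Module.IsPseudoNull (PowerSeries (padicCoeffIntegers ιg))
        (LinearMap.ker key.choose) :=
      BiquadraticEisensteinDescentEisensteinHeartFlatCMInertBadKPrimeCharIdealBaseChange.isPseudoNull_of_finite
    -- two-variable torsion from the one-variable torsion premise + control (determinant trick)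
    have hs := TwoVariableDescent.exists_constantCoeff_ne_zero_of_control
      (A := PowerSeries (padicCoeffIntegers ιg))
      (XBig κ' (AnticyclotomicBigGaloisRep κ (Δ.selfDualCofreeRepOver K)) 𝔭bar (↑S))
      (XBig κ (Δ.selfDualCofreeRepOver K) 𝔭bar (↑S)) h26 key.choose hpn
    have htors₂ := TwoVariableDescent.isTorsion_of_exists_constantCoeff_ne_zero
      (A := PowerSeries (padicCoeffIntegers ιg))
      (XBig κ' (AnticyclotomicBigGaloisRep κ (Δ.selfDualCofreeRepOver K)) 𝔭bar (↑S)) hs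
    -- the two-variable core WITH THE ♭ PIN, for this cyclotomic `κ'`
    obtain ⟨Q₂, ⟨c, hc⟩, hle⟩ := hFW ι g ιg Δ K 𝔭 𝔭bar κ γ S h1 h2 h3 h4 h5 h6 h7 h8 h9 h10 h11 h12 h13
      h14 h15 h16 h17 h18 h19 h20 h21 h22 b h23 ΩK Ωp Q h24 h25 κ' γ' hκ' htors₂
    -- descent of the characteristic ideal along `T_c ↦ 0` with PSEUDO-NULL kernel (JSW Cor. 3.4.2, kernel form)
    have hdesc := TwoVariableDescent.charIdeal_le_map_constantCoeff_of_control
      (A := PowerSeries (padicCoeffIntegers ιg))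
      (XBig κ' (AnticyclotomicBigGaloisRep κ (Δ.selfDualCofreeRepOver K)) 𝔭bar (↑S))
      (XBig κ (Δ.selfDualCofreeRepOver K) 𝔭bar (↑S)) h26 key.choose key.choose_spec.1 hpn
    refine (Ideal.map_mono hdesc).trans ?_
    rw [TwoVariableDescent.map_map_constantCoeff_eq b]
    exact DivPin.map_constantCoeff_le_span_of_le_span_of_eq_mul hle hc


end ErratumChainSelfDualDivPin

/-! ## §2 (appended, imc-p1 g34) The ♭ pin SHAPE is STRICTLY weaker than the unit pin shape — a kernel witness

Over `B = ℤ` with frame `Q = T_a` and `J = (T_c + 2·T_a)`: the ♭ conclusion holds (`L₂ = T_c + 2 T_a`, cofactor `c = 2`), the unit-pinned one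
fails (a divisor `L₂` of `T_c + 2 T_a` with `L₂(T_c = 0) = u·T_a` forces, after `T_c ↦ 0`, `cc(M)·u = 2`, and after `T_a ↦ 0`, `φ(M)` a unit of
`ℤ⟦T_c⟧` — so `2` would be a unit of `ℤ`). This certifies that `DivPin.exists_divPin_of_exists_unitPin` has no converse as a statement about
ideals of `B⟦T_a⟧⟦T_c⟧`; it says nothing about the actual Selmer characteristic ideals (where either pin is OPEN). -/

namespace DivPin

/-- The ♭-pinned conclusion HOLDS for `B = ℤ`, `Q = T_a`, `J = (T_c + 2·T_a)` (witness `L₂ = T_c + 2 T_a`, cofactor `2`). [folklore] -/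
theorem strictness_witness_divPin :
    ∃ L₂ : PowerSeries (PowerSeries ℤ),
      (∃ c : PowerSeries ℤ, PowerSeries.constantCoeff L₂ = c * PowerSeries.X) ∧
        Ideal.span {(PowerSeries.X : PowerSeries (PowerSeries ℤ)) +
            PowerSeries.C (PowerSeries.C (2 : ℤ)) * PowerSeries.C (PowerSeries.X : PowerSeries ℤ)} ≤ Ideal.span {L₂} := by
  refine ⟨PowerSeries.X + PowerSeries.C (PowerSeries.C (2 : ℤ)) * PowerSeries.C PowerSeries.X, ⟨PowerSeries.C (2 : ℤ), ?_⟩, le_rfl⟩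
  simp

/-- The UNIT-pinned conclusion FAILS for `B = ℤ`, `Q = T_a`, `J = (T_c + 2·T_a)`: no divisor of `T_c + 2 T_a` in `ℤ⟦T_a⟧⟦T_c⟧` restricts on
`T_c = 0` to a UNIT multiple of `T_a` (else `2 ∈ ℤˣ`). [folklore] -/
theorem strictness_witness_not_unitPin :
    ¬ ∃ L₂ : PowerSeries (PowerSeries ℤ),
      (∃ u : (PowerSeries ℤ)ˣ, PowerSeries.constantCoeff L₂ = (u : PowerSeries ℤ) * PowerSeries.X) ∧
        Ideal.span {(PowerSeries.X : PowerSeries (PowerSeries ℤ)) +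
            PowerSeries.C (PowerSeries.C (2 : ℤ)) * PowerSeries.C (PowerSeries.X : PowerSeries ℤ)} ≤ Ideal.span {L₂} := by
  rintro ⟨L₂, ⟨u, hu⟩, hJ⟩
  -- `L₂ ∣ P` where `P = T_c + 2 T_a`
  obtain ⟨M, hM⟩ := Ideal.mem_span_singleton'.1 (hJ (Ideal.mem_span_singleton_self _))
  -- (1) `T_c ↦ 0`: `2 T_a = cc(M) * (u * T_a)`, hence `cc(M) * u = 2`
  have h1 : PowerSeries.constantCoeff M * (u : PowerSeries ℤ) = PowerSeries.C (2 : ℤ) := by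
    have h := congrArg (PowerSeries.constantCoeff (R := PowerSeries ℤ)) hM
    simp only [map_mul, hu, map_add, PowerSeries.constantCoeff_X, PowerSeries.constantCoeff_C, zero_add] at h
    have h' : (PowerSeries.constantCoeff M * (u : PowerSeries ℤ)) * PowerSeries.X = PowerSeries.C (2 : ℤ) * PowerSeries.X := by
      rw [mul_assoc]; exact h
    exact mul_right_cancel₀ PowerSeries.X_ne_zero h'
  have h1' : PowerSeries.constantCoeff (PowerSeries.constantCoeff M) * PowerSeries.constantCoeff (u : PowerSeries ℤ) = 2 := by
    have h := congrArg (PowerSeries.constantCoeff (R := ℤ)) h1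
    rw [map_mul, PowerSeries.constantCoeff_C] at h
    exact h
  -- (2) `T_a ↦ 0` (the ring hom `map cc`): `T_c = φ(M) * φ(L₂)` with `cc(φ L₂) = 0`, so `φ(M)` is a unit
  set φ : PowerSeries (PowerSeries ℤ) →+* PowerSeries ℤ := PowerSeries.map (PowerSeries.constantCoeff (R := ℤ)) with hφ
  have hcc : ∀ F : PowerSeries (PowerSeries ℤ),
      PowerSeries.constantCoeff (φ F) = PowerSeries.constantCoeff (PowerSeries.constantCoeff F) := fun F ↦ by
    rw [hφ, ← PowerSeries.coeff_zero_eq_constantCoeff_apply, PowerSeries.coeff_map, PowerSeries.coeff_zero_eq_constantCoeff_apply]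
  have hL₂' : PowerSeries.constantCoeff (φ L₂) = 0 := by rw [hcc, hu]; simp
  obtain ⟨N, hN⟩ := (PowerSeries.X_dvd_iff).2 hL₂'
  have hP' : φ ((PowerSeries.X : PowerSeries (PowerSeries ℤ)) +
      PowerSeries.C (PowerSeries.C (2 : ℤ)) * PowerSeries.C (PowerSeries.X : PowerSeries ℤ)) = PowerSeries.X := by
    simp [hφ, PowerSeries.map_X, PowerSeries.map_C]
  have hM' : (PowerSeries.X : PowerSeries ℤ) = φ M * φ L₂ := by rw [← map_mul, hM, hP']
  have hunit : IsUnit (PowerSeries.constantCoeff (PowerSeries.constantCoeff M)) := by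
    rw [← hcc]
    rw [hN] at hM'
    have h : (φ M * N) * PowerSeries.X = 1 * PowerSeries.X := by
      rw [one_mul, mul_assoc, mul_comm N PowerSeries.X]; exact hM'.symm
    exact PowerSeries.isUnit_constantCoeff _ (IsUnit.of_mul_eq_one _ (mul_right_cancel₀ PowerSeries.X_ne_zero h))
  -- `cc(u)` is a unit of `ℤ`, so `2` would be a unit of `ℤ`
  have h2 : IsUnit (2 : ℤ) := by
    rw [← h1']
    exact hunit.mul (PowerSeries.isUnit_constantCoeff _ u.isUnit)
  exact absurd (Int.isUnit_iff.1 h2) (by decide)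

/-- **The ♭ pin shape is STRICTLY weaker**: there are `B`, `Q`, `J` (here `ℤ`, `T_a`, `(T_c + 2 T_a)`) for which the ♭ conclusion holds and
the unit-pinned conclusion fails — `exists_divPin_of_exists_unitPin` has no converse. [folklore] -/
theorem exists_divPin_and_not_unitPin :
    ∃ (J : Ideal (PowerSeries (PowerSeries ℤ))) (Q : PowerSeries ℤ),
      (∃ L₂ : PowerSeries (PowerSeries ℤ),
        (∃ c : PowerSeries ℤ, PowerSeries.constantCoeff L₂ = c * Q) ∧ J ≤ Ideal.span {L₂}) ∧
      ¬ (∃ L₂ : PowerSeries (PowerSeries ℤ),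
        (∃ u : (PowerSeries ℤ)ˣ, PowerSeries.constantCoeff L₂ = (u : PowerSeries ℤ) * Q) ∧ J ≤ Ideal.span {L₂}) :=
  ⟨_, _, strictness_witness_divPin, strictness_witness_not_unitPin⟩

end DivPin

end Summit.BirchSwinnertonDyer.BirchSwinnertonDyer.Theorems.ErratumThm23TwoVariable

end
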